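import Summits.Ventures.PercRepro.ProfilePointedCircuitClassesStarSharpLoopB

/-!
# PercRepro — THE ALL-ON CORE OF `StarNineSharp` (THE LOOP REGIME OF D0), PART D: THREE DEFECTS, THE EXCLUDED PATTERNS
(p5, gen 55; `proofs/P5-GM1.md` §82 ADD 2 (f))

Three defects with only two C-points among their endpoints would be `{a, b}`, `{a, u}`, `{b, u′}` with `u, u′ ∉ C`
(every other configuration of the C-endpoint sets has three points in its union or contains two defects sharing their
unique C-endpoint, settled by `cpoints_of_shared_endpoint`).  Both shapes are impossible:
* `not_triangle_bad` (`u = u′`): a B1 defect `{a, u}` makes `ρ(X − u) = 4`, a B2 defect makes it `3`, so `{a, u}`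
  and `{b, u}` have the same type — both B1: the planes `cl{b, p, q} ∋ e`, `cl{a, p, q} ∋ e` meet in `{p, q} + e` of
  rank `≤ 2`, so `e ∈ cl{p, q}` and `f ∈ cl{e, u} ⊆ cl{u, p, q}`, against `ρ({u, p, q} + f) = 4`; both B2: `a, b ∈ cl{f, u}`
  and then `f, u ∈ cl{a, b} ⊆ cl(X − u)` of rank 3 absorbs `X`;
* `not_path_bad` (`u ≠ u′`): part D1.
-/

open scoped Matroid

namespace PercRepro.Cogirth

open Finset ThmH Skew Shadow Profile

open Classical

variable {α : Type} [DecidableEq α] {N : Matroid α} [N.Finite]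

section StarSharpLoopD

variable {b b' : α}

/-- `{a, b, u, p, q} = {a, u, b, p, q}`. -/
theorem quint_swap_bu (a b u p q : α) : ({a, b, u, p, q} : Finset α) = {a, u, b, p, q} := by
  ext x; simp only [mem_insert, mem_singleton]; tauto

/-- `{a, b, u, p, q} = {b, u, a, p, q}`. -/
theorem quint_rot_bua (a b u p q : α) : ({a, b, u, p, q} : Finset α) = {b, u, a, p, q} := by
  ext x; simp only [mem_insert, mem_singleton]; tauto

/-- `{b, a, p, q} = {a, b, p, q}`. -/
theorem quad_swap12' (a b p q : α) : ({b, a, p, q} : Finset α) = {a, b, p, q} := by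
  ext x; simp only [mem_insert, mem_singleton]; tauto

/-- `insert e {p, q} ⊆ insert e {b, p, q} ∩ insert e {a, p, q}`. -/
theorem insert_e_pair_subset_inter' (e a b p q : α) :
    insert e ({p, q} : Finset α) ⊆ insert e {b, p, q} ∩ insert e {a, p, q} := by
  intro x hx; simp only [mem_insert, mem_singleton, mem_inter] at hx ⊢; tauto

/-- `{a, b, p, q} ⊆ insert e {b, p, q} ∪ insert e {a, p, q}`. -/
theorem quad_subset_union_planes (e a b p q : α) :
    ({a, b, p, q} : Finset α) ⊆ insert e {b, p, q} ∪ insert e {a, p, q} := by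
  intro x hx; simp only [mem_insert, mem_singleton, mem_union] at hx ⊢; tauto

/-- `{p, q} ⊆ {u, p, q}`. -/
theorem pair_subset_triple_tail (u p q : α) : ({p, q} : Finset α) ⊆ {u, p, q} := subset_insert _ _

/-- `{e, u} ⊆ insert e {u, p, q}`. -/
theorem pair_eu_subset_insert_e_triple (e u p q : α) : ({e, u} : Finset α) ⊆ insert e {u, p, q} :=
  pair_subset_insert_triple e u p q

/-- `insert a {f, u} = insert f {a, u}`. -/
theorem insert_a_fu_eq (a f u : α) : insert a ({f, u} : Finset α) = insert f {a, u} := by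
  ext x; simp only [mem_insert, mem_singleton]; tauto

/-- `{f, u} ⊆ insert a {f, u}`. -/
theorem pair_subset_insert_a (a f u : α) : ({f, u} : Finset α) ⊆ insert a {f, u} := subset_insert _ _

/-- `insert f {a, b} ⊆ insert b (insert a {f, u})`. -/
theorem insert_f_pair_subset_insert_insert (a b f u : α) :
    insert f ({a, b} : Finset α) ⊆ insert b (insert a {f, u}) := by
  intro x hx; simp only [mem_insert, mem_singleton] at hx ⊢; tauto

/-- `insert u {a, b} ⊆ insert b (insert a {f, u})`. -/
theorem insert_u_pair_subset_insert_insert (a b f u : α) :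
    insert u ({a, b} : Finset α) ⊆ insert b (insert a {f, u}) := by
  intro x hx; simp only [mem_insert, mem_singleton] at hx ⊢; tauto

/-- `{a, b} ⊆ {a, b, p, q}`. -/
theorem pair_ab_subset_quad (a b p q : α) : ({a, b} : Finset α) ⊆ {a, b, p, q} := pair_subset_quad a b p q

/-- `{a, b} ⊆ insert f {a, b, p, q}`. -/
theorem pair_ab_subset_insert_f_quad (f a b p q : α) : ({a, b} : Finset α) ⊆ insert f {a, b, p, q} :=
  (pair_subset_quad a b p q).trans (subset_insert _ _)

/-- `{a, b, u, p, q} ⊆ insert u (insert f {a, b, p, q})`. -/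
theorem quint_subset_insert_u_insert_f (f a b u p q : α) :
    ({a, b, u, p, q} : Finset α) ⊆ insert u (insert f {a, b, p, q}) := by
  intro x hx; simp only [mem_insert, mem_singleton] at hx ⊢; tauto

/-- `insert f {u, p, q} ⊆ insert f (insert e {u, p, q})`. -/
theorem insert_f_triple_subset_insert_f_insert_e (e f u p q : α) :
    insert f ({u, p, q} : Finset α) ⊆ insert f (insert e {u, p, q}) := insert_subset_insert _ (subset_insert _ _)

/-- **THE TRIANGLE `{a, b}, {a, u}, {b, u}` WITH `u ∉ C` IS IMPOSSIBLE** (`X = {a, b, u, p, q}`). -/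
theorem not_triangle_bad {e f : α} (he : e ∈ gr N) (hf : f ∈ gr N) (hef : e ≠ f) (heb : e ≠ b) (heb' : e ≠ b')
    (he1 : ∀ y ∈ ((((gr N).erase b).erase b').erase f).erase e, rk N {e, y} = 2)
    (hf1 : ∀ y ∈ ((((gr N).erase b).erase b').erase f).erase e, rk N {f, y} = 2)
    (hfc : ∀ y ∈ ((((gr N).erase b).erase b').erase f).erase e, rk N (((((gr N).erase b).erase b').erase f).erase y) = 4)
    (hX : rk N (((((gr N).erase b).erase b').erase f).erase e) = 4) (hef2 : rk N {e, f} = 2)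
    {a u p q : α} {bq : α} (hab : a ≠ bq) (hau : a ≠ u) (hbu : bq ≠ u) (hup : u ≠ p) (huq : u ≠ q)
    (hu : u ∈ ((((gr N).erase b).erase b').erase f).erase e)
    (hXeq : ((((gr N).erase b).erase b').erase f).erase e = {a, bq, u, p, q})
    (hYab : rk N (insert e {a, bq}) = 3) (hYcab : rk N (insert f {u, p, q}) = 4)
    (hYau : rk N (insert e {a, u}) = 3) (hYcau : rk N (insert f {bq, p, q}) = 4)
    (hbau : ¬ (rk N (insert f {a, u}) = 3 ∧ rk N (insert e {bq, p, q}) = 4))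
    (hYbu : rk N (insert e {bq, u}) = 3) (hYcbu : rk N (insert f {a, p, q}) = 4)
    (hbbu : ¬ (rk N (insert f {bq, u}) = 3 ∧ rk N (insert e {a, p, q}) = 4))
    (hu' : ¬ (rk N {e, f, u} = 3 ∧ rk N {a, bq, p, q} = 4)) : False := by
  have hE7g : ((gr N).erase b).erase b' ⊆ gr N := (erase_subset _ _).trans (erase_subset _ _)
  have hXg : ((((gr N).erase b).erase b').erase f).erase e ⊆ gr N :=
    ((erase_subset _ _).trans (erase_subset _ _)).trans hE7g
  have ha : a ∈ ((((gr N).erase b).erase b').erase f).erase e := by rw [hXeq]; exact mem_insert_self _ _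
  have hb : bq ∈ ((((gr N).erase b).erase b').erase f).erase e := by
    rw [hXeq]; exact mem_insert_of_mem (mem_insert_self _ _)
  have hp : p ∈ ((((gr N).erase b).erase b').erase f).erase e := by
    rw [hXeq]; exact mem_insert_of_mem (mem_insert_of_mem (mem_insert_of_mem (mem_insert_self _ _)))
  have hq : q ∈ ((((gr N).erase b).erase b').erase f).erase e := by
    rw [hXeq]
    exact mem_insert_of_mem (mem_insert_of_mem (mem_insert_of_mem (mem_insert_of_mem (mem_singleton_self _))))
  have hag := hXg ha
  have hbg := hXg hb
  have hug := hXg hu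
  have hpg := hXg hp
  have hqg := hXg hq
  have hau2 := rk_pair_eq_two_of_insert_e he hag hug hYau
  have hbu2 := rk_pair_eq_two_of_insert_e he hbg hug hYbu
  have hab2 := rk_pair_eq_two_of_insert_e he hag hbg hYab
  have hupq3 := rk_triple_eq_three_of_insert_f hf hug hpg hqg hYcab
  have hbpq3 := rk_triple_eq_three_of_insert_f hf hbg hpg hqg hYcau
  -- ranges
  have hfau_lo : rk N ({a, u} : Finset α) ≤ rk N (insert f ({a, u} : Finset α)) := rk_mono' (subset_insert _ _)
  have hfau_hi := rk_insert_le_add_one (N := N) hf (X := ({a, u} : Finset α)) (by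
    intro x hx; simp only [mem_insert, mem_singleton] at hx; rcases hx with rfl | rfl <;> assumption)
  have hfbu_lo : rk N ({bq, u} : Finset α) ≤ rk N (insert f ({bq, u} : Finset α)) := rk_mono' (subset_insert _ _)
  have hfbu_hi := rk_insert_le_add_one (N := N) hf (X := ({bq, u} : Finset α)) (by
    intro x hx; simp only [mem_insert, mem_singleton] at hx; rcases hx with rfl | rfl <;> assumption)
  have hebpq_lo : rk N ({bq, p, q} : Finset α) ≤ rk N (insert e ({bq, p, q} : Finset α)) := rk_mono' (subset_insert _ _)
  have hebpq_hi := rk_insert_le_add_one (N := N) he (X := ({bq, p, q} : Finset α)) (by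
    intro x hx; simp only [mem_insert, mem_singleton] at hx; rcases hx with rfl | rfl | rfl <;> assumption)
  have heapq_lo : rk N ({a, p, q} : Finset α) ≤ rk N (insert e ({a, p, q} : Finset α)) := rk_mono' (subset_insert _ _)
  have heapq_hi := rk_insert_le_add_one (N := N) he (X := ({a, p, q} : Finset α)) (by
    intro x hx; simp only [mem_insert, mem_singleton] at hx; rcases hx with rfl | rfl | rfl <;> assumption)
  have hapq3 := rk_triple_eq_three_of_insert_f hf hag hpg hqg hYcbu
  have hefu_lo : rk N ({e, u} : Finset α) ≤ rk N ({e, f, u} : Finset α) := rk_mono' (pair_et_subset_eft e f u)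
  have hefu_hi := rk_insert_le_add_one (N := N) hug (X := ({e, f} : Finset α)) (by
    intro x hx; simp only [mem_insert, mem_singleton] at hx; rcases hx with rfl | rfl <;> assumption)
  rw [← triple_eq_insert_last, hef2] at hefu_hi
  rw [he1 u hu] at hefu_lo
  -- the B1 facts: `ρ(X − u) = 4`
  have hK1a : rk N (insert e ({bq, p, q} : Finset α)) = 3 → rk N ({a, bq, p, q} : Finset α) = 4 := fun hB1 =>
    rk_quad_eq_four_of_B1 he hf hef heb heb' hfc hau hbu.symm hup huq hu (by rw [hXeq, quint_swap_bu]) hYcau hB1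
  have hK1b : rk N (insert e ({a, p, q} : Finset α)) = 3 → rk N ({a, bq, p, q} : Finset α) = 4 := by
    intro hB1
    have := rk_quad_eq_four_of_B1 he hf hef heb heb' hfc hbu hau.symm hup huq hu (by rw [hXeq, quint_rot_bua]) hYcbu hB1
    rw [quad_swap12'] at this
    exact this
  -- the B2 facts: `ρ{e, f, u} = 3`
  have hK2a : rk N (insert f ({a, u} : Finset α)) = 2 → rk N ({e, f, u} : Finset α) = 3 := fun hB2 =>
    rk_eft_eq_three_of_B2 he hf hf1 hef2 hu hYau hB2
  have hK2b : rk N (insert f ({bq, u} : Finset α)) = 2 → rk N ({e, f, u} : Finset α) = 3 := fun hB2 =>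
    rk_eft_eq_three_of_B2 he hf hf1 hef2 hu hYbu hB2
  have hT1 : rk N (insert f ({a, u} : Finset α)) = 2 ∨ rk N (insert e ({bq, p, q} : Finset α)) = 3 := by
    by_contra hne
    push Not at hne
    exact hbau ⟨by omega, by omega⟩
  have hT2 : rk N (insert f ({bq, u} : Finset α)) = 2 ∨ rk N (insert e ({a, p, q} : Finset α)) = 3 := by
    by_contra hne
    push Not at hne
    exact hbbu ⟨by omega, by omega⟩
  rcases hT1 with hB2a | hB1a <;> rcases hT2 with hB2b | hB1b
  · -- (B2, B2): `a, bq ∈ cl{f, u}`, so `f, u ∈ cl{a, bq} ⊆ cl(X − u)` of rank 3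
    have hefu3 := hK2a hB2a
    have hle : rk N ({a, bq, p, q} : Finset α) ≤ 3 := by
      have h1 : ¬ rk N ({a, bq, p, q} : Finset α) = 4 := fun h' => hu' ⟨hefu3, h'⟩
      have h2 := rk_le_card' (M := N) ({a, bq, p, q} : Finset α)
      have h3 : ({a, bq, p, q} : Finset α).card ≤ 4 := by
        calc ({a, bq, p, q} : Finset α).card ≤ ({bq, p, q} : Finset α).card + 1 := card_insert_le _ _
          _ ≤ ({p, q} : Finset α).card + 1 + 1 := by gcongr; exact card_insert_le _ _
          _ ≤ ({q} : Finset α).card + 1 + 1 + 1 := by gcongr; exact card_insert_le _ _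
          _ = 4 := by rw [card_singleton]
      omega
    -- `a ∈ cl{f, u}` and `bq ∈ cl{f, u}`
    have ha_fu : rk N (insert a ({f, u} : Finset α)) = rk N ({f, u} : Finset α) := by
      rw [insert_a_fu_eq, hB2a, hf1 u hu]
    have hb_fu : rk N (insert bq ({f, u} : Finset α)) = rk N ({f, u} : Finset α) := by
      rw [insert_a_fu_eq, hB2b, hf1 u hu]
    have h1 := rk_insert_eq_of_rk_insert_eq_subset' (N := N) (S := ({f, u} : Finset α))
      (S' := insert a ({f, u} : Finset α)) (w := bq) (pair_subset_insert_a a f u) hb_fu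
    rw [ha_fu, hf1 u hu] at h1
    -- hence `f ∈ cl{a, bq}` and `u ∈ cl{a, bq}`
    have hf_ab : rk N (insert f ({a, bq} : Finset α)) = rk N ({a, bq} : Finset α) := by
      have h2 : rk N (insert f ({a, bq} : Finset α)) ≤ rk N (insert bq (insert a ({f, u} : Finset α))) :=
        rk_mono' (insert_f_pair_subset_insert_insert a bq f u)
      have h3 : rk N ({a, bq} : Finset α) ≤ rk N (insert f ({a, bq} : Finset α)) := rk_mono' (subset_insert _ _)
      omega
    have hu_ab : rk N (insert u ({a, bq} : Finset α)) = rk N ({a, bq} : Finset α) := by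
      have h2 : rk N (insert u ({a, bq} : Finset α)) ≤ rk N (insert bq (insert a ({f, u} : Finset α))) :=
        rk_mono' (insert_u_pair_subset_insert_insert a bq f u)
      have h3 : rk N ({a, bq} : Finset α) ≤ rk N (insert u ({a, bq} : Finset α)) := rk_mono' (subset_insert _ _)
      omega
    have h4 := rk_insert_eq_of_rk_insert_eq_subset' (N := N) (S := ({a, bq} : Finset α))
      (S' := ({a, bq, p, q} : Finset α)) (w := f) (pair_ab_subset_quad a bq p q) hf_ab
    have h5 := rk_insert_eq_of_rk_insert_eq_subset' (N := N) (S := ({a, bq} : Finset α))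
      (S' := insert f ({a, bq, p, q} : Finset α)) (w := u) (pair_ab_subset_insert_f_quad f a bq p q) hu_ab
    have h6 : rk N (((((gr N).erase b).erase b').erase f).erase e) ≤
        rk N (insert u (insert f ({a, bq, p, q} : Finset α))) := by
      rw [hXeq]; exact rk_mono' (quint_subset_insert_u_insert_f f a bq u p q)
    rw [hX, h5, h4] at h6
    omega
  · -- (B2 for `{a, u}`, B1 for `{bq, u}`): `ρ(X − u)` is 3 and 4
    have hefu3 := hK2a hB2a
    have h4 := hK1b hB1b
    exact hu' ⟨hefu3, h4⟩
  · -- (B1 for `{a, u}`, B2 for `{bq, u}`)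
    have hefu3 := hK2b hB2b
    have h4 := hK1a hB1a
    exact hu' ⟨hefu3, h4⟩
  · -- (B1, B1): `e ∈ cl{p, q}`, and `f ∈ cl{e, u}` puts `f` into `cl{u, p, q}`
    have h4 := hK1a hB1a
    have hefu2 : rk N ({e, f, u} : Finset α) = 2 := by
      have : ¬ rk N ({e, f, u} : Finset α) = 3 := fun h' => hu' ⟨h', h4⟩
      omega
    have hpq2 : rk N ({p, q} : Finset α) = 2 := by
      have h1 := rk_insert_le_add_one (N := N) hug (X := ({p, q} : Finset α)) (by
        intro x hx; simp only [mem_insert, mem_singleton] at hx; rcases hx with rfl | rfl <;> assumption)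
      have h2 := rk_le_card' (M := N) ({p, q} : Finset α)
      have h3 : ({p, q} : Finset α).card ≤ 2 := by
        calc ({p, q} : Finset α).card ≤ ({q} : Finset α).card + 1 := card_insert_le _ _
          _ = 2 := by rw [card_singleton]
      omega
    have hepq : rk N (insert e ({p, q} : Finset α)) ≤ 2 :=
      rk_le_two_of_two_planes (N := N) (insert_e_pair_subset_inter' e a bq p q) (quad_subset_union_planes e a bq p q)
        h4 (by omega) (by omega)
    have hepq' : rk N (insert e ({p, q} : Finset α)) = rk N ({p, q} : Finset α) := by
      have : rk N ({p, q} : Finset α) ≤ rk N (insert e ({p, q} : Finset α)) := rk_mono' (subset_insert _ _)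
      omega
    have h5 := rk_insert_eq_of_rk_insert_eq_subset' (N := N) (S := ({p, q} : Finset α))
      (S' := ({u, p, q} : Finset α)) (w := e) (pair_subset_triple_tail u p q) hepq'
    have hfeu : rk N (insert f ({e, u} : Finset α)) = rk N ({e, u} : Finset α) := by
      rw [insert_pair_eq_mid, hefu2, he1 u hu]
    have h6 := rk_insert_eq_of_rk_insert_eq_subset' (N := N) (S := ({e, u} : Finset α))
      (S' := insert e ({u, p, q} : Finset α)) (w := f) (pair_eu_subset_insert_e_triple e u p q) hfeu
    have h7 : rk N (insert f ({u, p, q} : Finset α)) ≤ rk N (insert f (insert e ({u, p, q} : Finset α))) :=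
      rk_mono' (insert_f_triple_subset_insert_f_insert_e e f u p q)
    rw [hYcab, h6, h5, hupq3] at h7
    omega

end StarSharpLoopD

end PercRepro.Cogirth
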